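import Summits.MatrixMultiplication.OmegaCensus.SmallFormats.MatMul22nRankGF7Slack5Search
import HarnessLib

/-!
# ω-census family (a): replay of the slack-5 search certificate, CHECK A part 3 of 12 (elements `56 ≤ h < 84`)

Cell `pub-omega` (unit `pub-omega-tensor-g16`), topic `Summits/MatrixMultiplication/OmegaCensus` (sub-folder `SmallFormats`).
Framing (verbatim): lottery ticket; floor = certified bounds/negative ranges. HONEST FRAMING: machine-generated kernel replay
(`pub-omega-tensor-g16/code/gen5_runs.py`): `levelsOK5n h = true` for the elements `56 ≤ h < 84` of `PGL₂(7)`: for every slot `(c, h)`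
(`c < 656`) and bucket level, if the key of its column is visited then the bucket holds an entry with that column (SIMD key planes,
`MatMul22nRankGF7Plane`). Meaning: `slotOK5_of_levelsOK5` (`MatMul22nRankGF7Slack5SearchSound`). Nothing here is progress on `ω`.
-/

namespace Summit.MatrixMultiplication.OmegaCensus.SmallFormats

set_option Elab.async false

set_option maxRecDepth 100000 in
set_option maxHeartbeats 400000000 in
/-- Elements `56 ≤ h < 60`. -/
theorem levelsOK5_ok_56_60 : ∀ h : Fin 336, 56 ≤ h.val → h.val < 60 → levelsOK5n h.val = true := by decide +kernel

set_option maxRecDepth 100000 in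
set_option maxHeartbeats 400000000 in
/-- Elements `60 ≤ h < 64`. -/
theorem levelsOK5_ok_60_64 : ∀ h : Fin 336, 60 ≤ h.val → h.val < 64 → levelsOK5n h.val = true := by decide +kernel

set_option maxRecDepth 100000 in
set_option maxHeartbeats 400000000 in
/-- Elements `64 ≤ h < 68`. -/
theorem levelsOK5_ok_64_68 : ∀ h : Fin 336, 64 ≤ h.val → h.val < 68 → levelsOK5n h.val = true := by decide +kernel

set_option maxRecDepth 100000 in
set_option maxHeartbeats 400000000 in
/-- Elements `68 ≤ h < 72`. -/
theorem levelsOK5_ok_68_72 : ∀ h : Fin 336, 68 ≤ h.val → h.val < 72 → levelsOK5n h.val = true := by decide +kernel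

set_option maxRecDepth 100000 in
set_option maxHeartbeats 400000000 in
/-- Elements `72 ≤ h < 76`. -/
theorem levelsOK5_ok_72_76 : ∀ h : Fin 336, 72 ≤ h.val → h.val < 76 → levelsOK5n h.val = true := by decide +kernel

set_option maxRecDepth 100000 in
set_option maxHeartbeats 400000000 in
/-- Elements `76 ≤ h < 80`. -/
theorem levelsOK5_ok_76_80 : ∀ h : Fin 336, 76 ≤ h.val → h.val < 80 → levelsOK5n h.val = true := by decide +kernel

set_option maxRecDepth 100000 in
set_option maxHeartbeats 400000000 in
/-- Elements `80 ≤ h < 84`. -/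
theorem levelsOK5_ok_80_84 : ∀ h : Fin 336, 80 ≤ h.val → h.val < 84 → levelsOK5n h.val = true := by decide +kernel

/-- CHECK A for the elements `56 ≤ h < 84`. -/
theorem levelsOK5_run_3 : ∀ h : Fin 336, 56 ≤ h.val → h.val < 84 → levelsOK5n h.val = true := by
  intro h hlo hhi
  by_cases h60 : h.val < 60
  · exact levelsOK5_ok_56_60 h (by omega) h60
  by_cases h64 : h.val < 64
  · exact levelsOK5_ok_60_64 h (by omega) h64
  by_cases h68 : h.val < 68
  · exact levelsOK5_ok_64_68 h (by omega) h68
  by_cases h72 : h.val < 72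
  · exact levelsOK5_ok_68_72 h (by omega) h72
  by_cases h76 : h.val < 76
  · exact levelsOK5_ok_72_76 h (by omega) h76
  by_cases h80 : h.val < 80
  · exact levelsOK5_ok_76_80 h (by omega) h80
  exact levelsOK5_ok_80_84 h (by omega) hhi

end Summit.MatrixMultiplication.OmegaCensus.SmallFormats
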